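import Summits.BirchSwinnertonDyer.BirchSwinnertonDyer.Theses.ErratumRoadFive
import Summits.BirchSwinnertonDyer.BirchSwinnertonDyer.Theorems.ErratumRoadFiveErratumThm23DecOfTwoVarCore
import Summits.BirchSwinnertonDyer.BirchSwinnertonDyer.Theorems.ErratumRoadFiveIMCDivRoadFFFittingFrameBOfThm23Dec
import HarnessLib
import Summits.BirchSwinnertonDyer.BirchSwinnertonDyer.Theorems.ErratumRoadFiveKernelFromPrintBOfFacts

/-!
# K2 (route ErratumRoadFive) — the deciding theorem's conclusion with crux 25505 `ErratumThm23SigmaLe` REPLACED BY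
# the two-variable core S1 alone: the `¬(dec)` corner of the E-free crux is outside K2's cone
# (certificate ∕ glue turnkey; helper, `--supports stmt-BirchSwinnertonDyer-25505`)

Cell `bsd-stepL` (run/shared/lean/pub/bsd-stepL/), seat `bsd-stepL-imc-p1` (prover g22, 2026-08-28). Theorems only (no
definition, no named fact, no `sorry`, no instance, no notation). Memo `HOME/imc-p1/g22/CORNER-25505-imc-p1-g22.md`.

## What this file proves

1. `imcDivAtErratumDataAllR_of_twoVarCore_of_frames_of_sigmaLocal_of_reduction (hFW : ‹S1›) (hMF) (hloc) (hF) :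
   Theses.ErratumRoadFive.IMCDivAtErratumDataAllR` — the H3 open input of K2 (binder `h3` inside `closes`) from
   S1 = the registered stub `stub_FW21_twoVarSigmaLePinned` of `Cruxes/ErratumThm23SigmaLe/Lines/erratum_chain.lean` VERBATIM
   (OPEN: [FW21, Thm. 4.41] Σ-imprimitive + App. B Cor. 7.21 ∕ L. 7.22 + weight-`k` [CGS25 2.4.5]-type restriction, pinned),
   the items `ErratumHidaMemberFrames` (25506, citable), `JSWSigmaLocalCharIdeal` (20495, proved), `PublishedInputsIMCReduction`
   (19283) — exactly as `closes` derives `h3` from `h23 : ErratumThm23SigmaLe`, but through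
   `ErratumChainDec.erratumThm23SigmaLe_dec_of_twoVarCore` (p634294: erratum Thm. 2.3 «⊂» ON THE (dec) LOCUS from S1) and
   `P2.RoadFF.fittingCongruenceFrameAtErratumDataB_of_thm23Dec_of_frames` (p634547: the Road-FF consumer fed by the
   (dec)-restricted fact, (dec) for the Hida members discharged from (iv) `E(ℚ_p)[p] = 0` + the congruence (b)).
2. `multiplicativeRankOne_of_twoVarCore_of_items` — the rung-K2a leaf `X11b.MultiplicativeRankOne` from S1 and the
   fourteen OTHER binders of `Theses.ErratumRoadFive.closes` (rev of record), i.e. `closes` with `h23 : ErratumThm23SigmaLe`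
   replaced by `hFW : ‹S1›`; body = `closes`' body with `h3` from (1).

WHY: the E-free crux 25505 (F4♯ = Castella's erratum Thm. 2.3 «⊂» for ONE newform, no (dec) binder) has a corner — the
newforms with `a_p(g) ≡ 1 (mod ϖ)` AND `V_g|_{G_{ℚ_p}}` split — where the descent [JSW17, Cor. 3.4.2] has no proof
(the two-variable local invariants `𝓜^{G_{K_𝔭̄}}` are infinite there; (CG) "locally split ⟹ CM" is open in weight
`k > 2`, Castella–Wang-Erickson JEMS 2021 §1.1) and the erratum supplies none; K2 never enters it. So the honest open
input of K2 along ROAD FF is S1 by name; this file is the kernel certificate (and a `--closes-file` turnkey body for a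
planner edit replacing binder `h23` by an item whose text is S1 — director-gated, not requested here).

HONEST FRAMING: CONDITIONAL on every displayed hypothesis (S1 OPEN; the other fourteen are K2's items of record, open or
closed as the ledger says); this file closes NO item and books nothing; the anticyclotomic main conjecture is asserted
nowhere; BSD is proved for no pair; no census number moves (T7).

[claim: FouquetWan2021, Thm. 4.41, App. B Cor. 7.21, Lemma 7.22, status: under-review]
[cite: Castella2018Erratum, Thm. 1.1 (iv), Lemma 2.1, Thm. 2.3, (2.4)–(2.5) (pp. 1–4)]
[cite: JetchevSkinnerWan2017, §3.4, Lemma 3.4.1, Cor. 3.4.2 (arXiv:1512.06894 p. 14)]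
-/

noncomputable section

open scoped Classical

open PowerSeries NumberField IsDedekindDomain Field
  Literature.NumberTheory.EllipticCurves Literature.NumberTheory.EllipticCurves.ModularForms
  Literature.NumberTheory.EllipticCurves.BigGaloisRep Literature.NumberTheory.EllipticCurves.GreenbergSelmer
  Literature.NumberTheory.GaloisRepresentations

-- D-0017: single-problem summit, the namespace repeats the problem name by design.
set_option linter.dupNamespace false
set_option autoImplicit false

namespace Summit.BirchSwinnertonDyer.BirchSwinnertonDyer.Theorems.ErratumThm23TwoVariable.ClosesOfTwoVarCore

open Summit.BirchSwinnertonDyer.BirchSwinnertonDyer.Theses.ErratumRoadFive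

set_option maxHeartbeats 400000 in
/-- **K2's H3 open input `IMCDivAtErratumDataAllR` from the two-variable core S1** (+ the citable member frames 25506, the
proved Σ-local fact 20495 and the reduction support 19283) — `closes`' derivation of `h3`, with crux 25505 replaced by S1 via
p634294 + p634547. [cite: Castella2018Erratum, proof of Thm. 1.1 and of Thm. 2.3 (p. 4)] -/
theorem imcDivAtErratumDataAllR_of_twoVarCore_of_frames_of_sigmaLocal_of_reduction
    (hFW :
      ∀ {p : ℕ} [Fact p.Prime] (ι : PadicAlgCl p ≃+* ℂ) {M : ℕ} [NeZero M] {k : ℤ}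
        (g : CuspForm (CongruenceSubgroup.Gamma0 M) k) (ιg : coeffField g →+* PadicAlgCl p)
        (Δ : OrdinaryNewformDatum g p ιg)
        (K : Type) [Field K] [NumberField K] (𝔭 𝔭bar : HeightOneSpectrum (𝓞 K)) (κ : ZpExtension K p)
        (γ : absoluteGaloisGroup K) [Fact (κ.IsTopGenerator γ)] (S : Finset (HeightOneSpectrum (𝓞 K))),
        IsNewform0 g → 2 ≤ k → Even k → 3 ≤ M → ¬ p ∣ M → 3 < p →
        (∀ x : coeffField g, ι (ιg x) = (x : ℂ)) →
        ‖ιg ⟨(UpperHalfPlane.qExpansion 1 ⇑g).coeff p, coeff_mem_coeffField g p⟩‖ = 1 →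
        IsImaginaryQuadratic K → (∃ β : ℤ, (4 * M : ℤ) ∣ β ^ 2 - NumberField.discr K) →
        ((Ideal.span {(p : ℤ)}).primesOver (𝓞 K)).ncard = 2 →
        ((p : ℕ) : 𝓞 K) ∈ 𝔭.asIdeal →
        (∀ (w : InfinitePlace K) (x : 𝓞 K), x ∈ 𝔭.asIdeal ↔ ‖ι.symm (w.embedding (x : K))‖ < 1) →
        ((p : ℕ) : 𝓞 K) ∈ 𝔭bar.asIdeal → 𝔭bar ≠ 𝔭 →
        SkinnerUrban2014.IsResiduallyIrreducible Δ →
        (∃ v : HeightOneSpectrum (𝓞 ℚ), SkinnerUrban2014.IsResiduallyRamifiedAt Δ v ∧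
          ((Rat.HeightOneSpectrum.primesEquiv v : Nat.Primes) : ℕ) ∣ M ∧
          ¬ ((Rat.HeightOneSpectrum.primesEquiv v : Nat.Primes) : ℕ) ^ 2 ∣ M ∧
          ((Ideal.span {(((Rat.HeightOneSpectrum.primesEquiv v : Nat.Primes) : ℕ) : ℤ)}).primesOver (𝓞 K)).ncard ≠ 2) →
        (((Ideal.span {(2 : ℤ)}).primesOver (𝓞 K)).ncard ≠ 2 → (2 ∣ M ∧ ¬ 4 ∣ M)) →
        (∀ ℓ : ℕ, ℓ.Prime → ℓ ∣ M → ((Ideal.span {(ℓ : ℤ)}).primesOver (𝓞 K)).ncard ≠ 2 →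
          ¬ ℓ ^ 2 ∣ M ∧ (UpperHalfPlane.qExpansion 1 ⇑g).coeff ℓ = -((ℓ : ℂ) ^ (k / 2 - 1).toNat)) →
        κ.IsAnticyclotomic → (∀ w ∈ S, ((p : ℕ) : 𝓞 K) ∉ w.asIdeal) →
        (∀ w : HeightOneSpectrum (𝓞 K), ((M : ℕ) : 𝓞 K) ∈ w.asIdeal → w ∈ S) →
        ∀ (b : padicCoeffIntegers ιg →+* PadicComplexInt p),
          (∀ x, ((b x : PadicComplexInt p) : ℂ_[p]) =
            algebraMap (PadicAlgCl p) ℂ_[p] (padicCoeffIntegers.toPadicAlgCl ιg x)) →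
        ∀ (ΩK : ℂ) (Ωp : (PadicComplexInt p)ˣ) (Q : PowerSeries (PadicComplexInt p)), ΩK ≠ 0 →
          IsBDPLFunctionWtSigmaInt ι 𝔭 κ γ g S ΩK ((Ωp : PadicComplexInt p) : ℂ_[p]) Q →
        -- the complementary (cyclotomic) direction `κ'` with generator `γ'`: `Γ_K = Γ⁺ ⊕ Γ⁻ ≅ ℤ_p²` for `p` odd
        ∀ (κ' : ZpExtension K p) (γ' : absoluteGaloisGroup K) [Fact (κ'.IsTopGenerator γ')], κ'.IsCyclotomic →
        ∀ [TopologicalSpace (PowerSeries (padicCoeffIntegers ιg))]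
          [TopologicalSpace (PowerSeries (PowerSeries (padicCoeffIntegers ιg)))]
          [ContinuousSMul (PowerSeries (PowerSeries (padicCoeffIntegers ιg)))
            (BigRepModule (PowerSeries (padicCoeffIntegers ιg)) p
              (BigRepModule (padicCoeffIntegers ιg) p (Cofree Δ.ρ (padicCoeffField ιg))))],
        -- premise: `X^Σ_K(A_g)` is `Λ_K`-torsion; conclusion: a two-variable frame pinned to `Q` on `X = 0` dividing `Ch_{Λ_K}(X^Σ_K(A_g))`
        Module.IsTorsion (PowerSeries (PowerSeries (padicCoeffIntegers ιg)))
            (XBig κ' (AnticyclotomicBigGaloisRep κ (Δ.cofreeRepOver K)) 𝔭bar (↑S)) →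
        ∃ Q₂ : PowerSeries (PowerSeries (PadicComplexInt p)),
          (∃ u : (PowerSeries (PadicComplexInt p))ˣ,
              PowerSeries.constantCoeff Q₂ = (u : PowerSeries (PadicComplexInt p)) * Q) ∧
          (XBig.charIdeal κ' (AnticyclotomicBigGaloisRep κ (Δ.cofreeRepOver K)) 𝔭bar (↑S)).map
              (PowerSeries.map (PowerSeries.map b)) ≤ Ideal.span {Q₂})
    (hMF : ErratumHidaMemberFrames) (hloc : JSWSigmaLocalCharIdeal) (hF : PublishedInputsIMCReduction) :
    IMCDivAtErratumDataAllR := fun W _ _ p _ ↦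
  Summit.BirchSwinnertonDyer.Rank1Residual.X11b.P2.imcDivIntCoreFrameAtErratumDataB_of_roadFF_fitting
    (Summit.BirchSwinnertonDyer.Rank1Residual.X11b.P2.RoadFF.sigmaDataAtErratumDataB_of_sigmaLocal_of_prop323_of_facts
      W p hloc Literature.NumberTheory.EllipticCurves.SkinnerUrban2014.prop323_XAc_equiv_XBigDecomp_holds
      hF.2.1 hF.2.2.2.1 hF.2.2.2.2.2.2.2.2.2.2.2.2.1 hF.2.2.2.2.2.2.2.2.2.2.2.2.2.1)
    (Summit.BirchSwinnertonDyer.Rank1Residual.X11b.P2.RoadFF.fittingCongruenceFrameAtErratumDataB_of_thm23Dec_of_frames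
      (ErratumChainDec.erratumThm23SigmaLe_dec_of_twoVarCore hFW) hMF W p)

set_option maxHeartbeats 400000 in
/-- **The rung-K2a leaf from S1 and the fourteen other binders of `Theses.ErratumRoadFive.closes`** — `closes` with
`h23 : ErratumThm23SigmaLe` (crux 25505) replaced by the two-variable core S1 (registered stub text verbatim); body =
`closes`' body, `h3` from `imcDivAtErratumDataAllR_of_twoVarCore_of_frames_of_sigmaLocal_of_reduction`. Certificate that
the `¬(dec)` corner of 25505 is outside K2's dependency cone. [cite: Castella2018Erratum, Thm. 1.1, Thm. 2.3 (pp. 1–4)] -/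
theorem multiplicativeRankOne_of_twoVarCore_of_items
    (hFW :
      ∀ {p : ℕ} [Fact p.Prime] (ι : PadicAlgCl p ≃+* ℂ) {M : ℕ} [NeZero M] {k : ℤ}
        (g : CuspForm (CongruenceSubgroup.Gamma0 M) k) (ιg : coeffField g →+* PadicAlgCl p)
        (Δ : OrdinaryNewformDatum g p ιg)
        (K : Type) [Field K] [NumberField K] (𝔭 𝔭bar : HeightOneSpectrum (𝓞 K)) (κ : ZpExtension K p)
        (γ : absoluteGaloisGroup K) [Fact (κ.IsTopGenerator γ)] (S : Finset (HeightOneSpectrum (𝓞 K))),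
        IsNewform0 g → 2 ≤ k → Even k → 3 ≤ M → ¬ p ∣ M → 3 < p →
        (∀ x : coeffField g, ι (ιg x) = (x : ℂ)) →
        ‖ιg ⟨(UpperHalfPlane.qExpansion 1 ⇑g).coeff p, coeff_mem_coeffField g p⟩‖ = 1 →
        IsImaginaryQuadratic K → (∃ β : ℤ, (4 * M : ℤ) ∣ β ^ 2 - NumberField.discr K) →
        ((Ideal.span {(p : ℤ)}).primesOver (𝓞 K)).ncard = 2 →
        ((p : ℕ) : 𝓞 K) ∈ 𝔭.asIdeal →
        (∀ (w : InfinitePlace K) (x : 𝓞 K), x ∈ 𝔭.asIdeal ↔ ‖ι.symm (w.embedding (x : K))‖ < 1) →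
        ((p : ℕ) : 𝓞 K) ∈ 𝔭bar.asIdeal → 𝔭bar ≠ 𝔭 →
        SkinnerUrban2014.IsResiduallyIrreducible Δ →
        (∃ v : HeightOneSpectrum (𝓞 ℚ), SkinnerUrban2014.IsResiduallyRamifiedAt Δ v ∧
          ((Rat.HeightOneSpectrum.primesEquiv v : Nat.Primes) : ℕ) ∣ M ∧
          ¬ ((Rat.HeightOneSpectrum.primesEquiv v : Nat.Primes) : ℕ) ^ 2 ∣ M ∧
          ((Ideal.span {(((Rat.HeightOneSpectrum.primesEquiv v : Nat.Primes) : ℕ) : ℤ)}).primesOver (𝓞 K)).ncard ≠ 2) →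
        (((Ideal.span {(2 : ℤ)}).primesOver (𝓞 K)).ncard ≠ 2 → (2 ∣ M ∧ ¬ 4 ∣ M)) →
        (∀ ℓ : ℕ, ℓ.Prime → ℓ ∣ M → ((Ideal.span {(ℓ : ℤ)}).primesOver (𝓞 K)).ncard ≠ 2 →
          ¬ ℓ ^ 2 ∣ M ∧ (UpperHalfPlane.qExpansion 1 ⇑g).coeff ℓ = -((ℓ : ℂ) ^ (k / 2 - 1).toNat)) →
        κ.IsAnticyclotomic → (∀ w ∈ S, ((p : ℕ) : 𝓞 K) ∉ w.asIdeal) →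
        (∀ w : HeightOneSpectrum (𝓞 K), ((M : ℕ) : 𝓞 K) ∈ w.asIdeal → w ∈ S) →
        ∀ (b : padicCoeffIntegers ιg →+* PadicComplexInt p),
          (∀ x, ((b x : PadicComplexInt p) : ℂ_[p]) =
            algebraMap (PadicAlgCl p) ℂ_[p] (padicCoeffIntegers.toPadicAlgCl ιg x)) →
        ∀ (ΩK : ℂ) (Ωp : (PadicComplexInt p)ˣ) (Q : PowerSeries (PadicComplexInt p)), ΩK ≠ 0 →
          IsBDPLFunctionWtSigmaInt ι 𝔭 κ γ g S ΩK ((Ωp : PadicComplexInt p) : ℂ_[p]) Q →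
        -- the complementary (cyclotomic) direction `κ'` with generator `γ'`: `Γ_K = Γ⁺ ⊕ Γ⁻ ≅ ℤ_p²` for `p` odd
        ∀ (κ' : ZpExtension K p) (γ' : absoluteGaloisGroup K) [Fact (κ'.IsTopGenerator γ')], κ'.IsCyclotomic →
        ∀ [TopologicalSpace (PowerSeries (padicCoeffIntegers ιg))]
          [TopologicalSpace (PowerSeries (PowerSeries (padicCoeffIntegers ιg)))]
          [ContinuousSMul (PowerSeries (PowerSeries (padicCoeffIntegers ιg)))
            (BigRepModule (PowerSeries (padicCoeffIntegers ιg)) p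
              (BigRepModule (padicCoeffIntegers ιg) p (Cofree Δ.ρ (padicCoeffField ιg))))],
        -- premise: `X^Σ_K(A_g)` is `Λ_K`-torsion; conclusion: a two-variable frame pinned to `Q` on `X = 0` dividing `Ch_{Λ_K}(X^Σ_K(A_g))`
        Module.IsTorsion (PowerSeries (PowerSeries (padicCoeffIntegers ιg)))
            (XBig κ' (AnticyclotomicBigGaloisRep κ (Δ.cofreeRepOver K)) 𝔭bar (↑S)) →
        ∃ Q₂ : PowerSeries (PowerSeries (PadicComplexInt p)),
          (∃ u : (PowerSeries (PadicComplexInt p))ˣ,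
              PowerSeries.constantCoeff Q₂ = (u : PowerSeries (PadicComplexInt p)) * Q) ∧
          (XBig.charIdeal κ' (AnticyclotomicBigGaloisRep κ (Δ.cofreeRepOver K)) 𝔭bar (↑S)).map
              (PowerSeries.map (PowerSeries.map b)) ≤ Ideal.span {Q₂})
    (hMF : ErratumHidaMemberFrames) (hloc : JSWSigmaLocalCharIdeal)
    (hrest : RamNoErratumDataAtFive) (hOff : OpenInputNotRam)
    (hF : PublishedInputsIMCReduction) (hVN : BDPValueContinuityInput)
    (hRes : EulerHalfNotRamNoInertSetAtFive) (h₃ : X11aLowerHalf) (h₄ : NonSurjCorner)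
    (h₅ : PublishedInputsFive) (hJL : ShimuraParametrizationDataNonempty) (hCO : PastenComponentOrdersInput)
    (hCTi : ShimuraCasselsTateLevelInputs) (hESi : ShimuraHeegnerEulerSystemInertPrintedR) :
    Summit.BirchSwinnertonDyer.Rank1Residual.X11b.MultiplicativeRankOne := by
  have h3 : IMCDivAtErratumDataAllR :=
    imcDivAtErratumDataAllR_of_twoVarCore_of_frames_of_sigmaLocal_of_reduction hFW hMF hloc hF
  obtain ⟨hGZ, hKo, hB, hSk, hWu', hGZK, hmod, hnf, hHL, hFHs, hMaz, hBDMTV, hFH, hPT, hEP⟩ := h₅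
  have hESg : Literature.NumberTheory.EllipticCurves.shimuraCurve_heegnerSystem_primitivesGuarded :=
    Summit.BirchSwinnertonDyer.BirchSwinnertonDyer.Theorems.primitivesGuarded_of_GZK_of_entire_of_primitivesFromFive
      hGZK hmod hESi
  have hKOi : ShimuraKolyvaginOrderBoundInertFromFive := by
    refine Summit.BirchSwinnertonDyer.BirchSwinnertonDyer.Theorems.shimuraKolyvaginOrderBoundInert_of_shimuraLabelsGuarded_of_casselsTate_of_poitouTate
      hPT ?_ hESg
    intro K _ _ W _ p M₀ hp hp2 hM₀ _ c hc hcc e hμ hadd₁ hadd₂ hgal halt hnd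
    obtain ⟨inv, hPT', hH3, hperf, hB', hPτ⟩ := hCTi K W p M₀ hp hp2 hM₀ c hc hcc e hμ hadd₁ hadd₂ hgal halt hnd
    exact ⟨inv, hPT', hH3, fun v ↦ (hperf v).1.injective, hB', hPτ⟩
  have hHKi : Literature.NumberTheory.EllipticCurves.shimuraCurve_heegnerPoint_grossZagier_kolyvagin_inert := by
    intro W _ _ p _ N _ K _ _ S Dt X W' _ P₀ hN hp5 hsurj hK hS hin hsp hpS hc hmin
    obtain ⟨-, y, degy, -, -, h0y, hvy, hLy, -⟩ := hESg W p N K S Dt X W' P₀ hN hp5 hsurj hK hS hin hsp hpS hc hmin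
    exact ⟨y, degy, h0y, hvy, hLy,
      hKOi W p N K S Dt X W' P₀ hN hp5 hsurj hK hS hin hsp hpS hc hmin y degy h0y hvy hLy⟩
  have h₁ : ∀ (W : WeierstrassCurve ℚ) [W.IsElliptic] [W.IsGloballyMinimal] (p : ℕ) [Fact p.Prime],
      Summit.BirchSwinnertonDyer.Rank1Residual.X11b.P2OpenInputOnTreeAt W p :=
    Summit.BirchSwinnertonDyer.BirchSwinnertonDyer.Theorems.KernelFromPrintB.openInputIMCBody_of_print_of_coreB_of_rest3_of_notRam_of_facts
      hVN h3 hF hWu' hrest hOff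
  exact Summit.BirchSwinnertonDyer.BirchSwinnertonDyer.Theorems.multiplicativeRankOne_of_endState_inert_notRamResidual
    hGZ hKo hB hSk hWu' hGZK hmod hnf hHL hFHs hMaz hBDMTV hFH hPT hEP hJL hCO hHKi h₁ hRes h₃ h₄

end Summit.BirchSwinnertonDyer.BirchSwinnertonDyer.Theorems.ErratumThm23TwoVariable.ClosesOfTwoVarCore

end
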